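import Summits.AtomisticToContinuum.HydrodynamicLimit.Theorems.CollisionIsometryCLTCollisionalTransferLocalityDefs
import Literature.MathematicalPhysics.KineticTheory.HardSphereEulerProofs
import Literature.MathematicalPhysics.KineticTheory.RelativeSpeedPairSums
import HarnessLib

/-!
# Static law of large numbers for the crux observable at equilibrium (line `hemisphere-affine-slaving`)

Helper file (`--supports stmt-AtomisticToContinuum-9518`, line `hemisphere-affine-slaving`, skeleton
v10.1, stub `obs_lln_const`, equilibrium-rung infrastructure) for the crux
`CollisionalTransferLocality`. The crux's observable is
`Obs ψ χ N s z = (N+1)⁻¹ Σᵢ (ψ(s,xᵢ)·vᵢ + χ(s,xᵢ)|vᵢ|²/2)`; this file proves its law of large numbers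
at one time under the HOMOGENEOUS local Gibbs law (activity `1`, mean velocity `0`, temperature `θ`):
for continuous `g : 𝕋³ → ℝ³`, `h : 𝕋³ → ℝ` and `δ > 0`,

  `P_N(δ < |(N+1)⁻¹ Σᵢ (Σⱼ g(xᵢ)ⱼ vᵢⱼ + h(xᵢ)|vᵢ|²/2) − (3θ/2) ∫ h|) → 0` as `N → ∞`,

given that the laws are probability measures and that the empirical density field satisfies its
law of large numbers with limit `∫ f` (exactly the two conclusions of the landed
`localGibbsLaw_const_densityLLN`), at a fixed reduced density `σ`: no smallness of `σ` is needed
here, it is entirely consumed by the density hypothesis.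

Proof (the tree's `localGibbs_lln_of_densityLLN`, re-run for this observable). Conditionally on the
positions the velocities are i.i.d. `N(0, θ id)` (`gaussMeasure 0 θ`), and the observable minus its
limit splits (`obsLLN_sub_limit_split`) into five pieces:
* three velocity fluctuations `(N+1)⁻¹ Σᵢ g(xᵢ)ⱼ vᵢⱼ`, `j = 0, 1, 2` (mark `v ↦ vⱼ`: centred,
  `integral_coord_gaussMeasure`; square integrable, `memLp_coord_gaussMeasure`);
* the kinetic-energy fluctuation `(N+1)⁻¹ Σᵢ h(xᵢ)(|vᵢ|²/2 − 3θ/2)` (mark `v ↦ |v|²/2 − 3θ/2`: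
  centred by `integral_norm_sq_gaussMeasure`, `E|v|² = 3θ`; square integrable,
  `memLp_energy_gaussMeasure`);
* the density term `(3θ/2)((N+1)⁻¹ Σᵢ h(xᵢ) − ∫ h)` (the hypothesis, `empiricalDensityField_eq_sum`).
Each fluctuation is `O((N+1)^{-1/2})` in probability by Bienaymé–Chebyshev, uniformly in the
positions (`localGibbsMeasure_velFluct_le`, rate `tendsto_ofReal_div_succ_mul`; here
`obsLLN_tendsto_velFluct_const`), and the five pieces are assembled by the union bound at levels `δ/5`
(`obsLLN_tendsto_measure_lt_abs_add`). Everything is folklore probability; nothing is cited and no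
dynamics enters (the flow argument only fixes the phase space, `localGibbsLaw_eq`).
-/

namespace Summit.AtomisticToContinuum.HydrodynamicLimit.Theorems.HemisphereAffineSlaving

open scoped BigOperators Topology Classical ENNReal InnerProductSpace
open Filter Set Function MeasureTheory

noncomputable section

open Literature.MathematicalPhysics.KineticTheory (T3 V3)
open ProbabilityTheory
open Literature.MathematicalPhysics.KineticTheory (gaussMeasure localGibbsMeasure localGibbsLaw_eq
  localGibbsMeasure_velFluct_le empiricalDensityField_eq_sum integral_coord_gaussMeasure
  memLp_coord_gaussMeasure integrable_norm_sq_gaussMeasure integral_norm_sq_gaussMeasure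
  memLp_energy_gaussMeasure exists_forall_abs_le_of_continuous tendsto_ofReal_div_succ_mul)

/-! ### Bookkeeping: the union bound and the algebraic splitting -/

/-- **Union bound for strict deviation events.** If `P_N(η₁ < |A_N|) → 0` and
`P_N(η₂ < |B_N|) → 0` then `P_N(η₁ + η₂ < |A_N + B_N|) → 0`. [folklore] -/
theorem obsLLN_tendsto_measure_lt_abs_add {Ω : ℕ → Type*} [∀ N, MeasurableSpace (Ω N)]
    {P : (N : ℕ) → Measure (Ω N)} {A B : (N : ℕ) → Ω N → ℝ} {η₁ η₂ : ℝ}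
    (hA : Tendsto (fun N => P N {z | η₁ < |A N z|}) atTop (𝓝 0))
    (hB : Tendsto (fun N => P N {z | η₂ < |B N z|}) atTop (𝓝 0)) :
    Tendsto (fun N => P N {z | η₁ + η₂ < |A N z + B N z|}) atTop (𝓝 0) := by
  refine tendsto_of_tendsto_of_tendsto_of_le_of_le tendsto_const_nhds (by simpa using hA.add hB)
    (fun N => zero_le) (fun N => ?_)
  calc P N {z | η₁ + η₂ < |A N z + B N z|}
      ≤ P N ({z | η₁ < |A N z|} ∪ {z | η₂ < |B N z|}) := by
        refine measure_mono fun z hz => ?_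
        simp only [Set.mem_setOf_eq, Set.mem_union] at hz ⊢
        by_contra hc
        obtain ⟨h1, h2⟩ := not_or.1 hc
        have := abs_add_le (A N z) (B N z)
        linarith [not_lt.1 h1, not_lt.1 h2]
    _ ≤ P N {z | η₁ < |A N z|} + P N {z | η₂ < |B N z|} := measure_union_le _ _

/-- The algebraic splitting of the observable minus its limit into the three coordinate velocity
fluctuations, the kinetic-energy fluctuation and the density term (with the library's cast
`((N + 1 : ℕ) : ℝ)⁻¹` of the normalisation). [folklore] -/
theorem obsLLN_sub_limit_split {N : ℕ} (z : Cfg N) (g : T3 → V3) (h : T3 → ℝ) (θ I : ℝ) :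
    ((N : ℝ) + 1)⁻¹ * (∑ i : Fin (N + 1), ((∑ j, g (z i).1 j * (z i).2 j) +
        h (z i).1 * (‖(z i).2‖ ^ 2 / 2))) - 3 * θ / 2 * I =
      ((N + 1 : ℕ) : ℝ)⁻¹ * (∑ i, g (z i).1 0 * (z i).2 0) +
        ((N + 1 : ℕ) : ℝ)⁻¹ * (∑ i, g (z i).1 1 * (z i).2 1) +
        ((N + 1 : ℕ) : ℝ)⁻¹ * (∑ i, g (z i).1 2 * (z i).2 2) +
        ((N + 1 : ℕ) : ℝ)⁻¹ * (∑ i, h (z i).1 * (‖(z i).2‖ ^ 2 / 2 - 3 * θ / 2)) +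
        3 * θ / 2 * (((N + 1 : ℕ) : ℝ)⁻¹ * (∑ i, h (z i).1) - I) := by
  have hsum : ∑ i : Fin (N + 1), ((∑ j, g (z i).1 j * (z i).2 j) +
      h (z i).1 * (‖(z i).2‖ ^ 2 / 2)) =
      (∑ i, g (z i).1 0 * (z i).2 0) + (∑ i, g (z i).1 1 * (z i).2 1) +
        (∑ i, g (z i).1 2 * (z i).2 2) +
        (∑ i, h (z i).1 * (‖(z i).2‖ ^ 2 / 2 - 3 * θ / 2)) + 3 * θ / 2 * ∑ i, h (z i).1 := by
    rw [Finset.mul_sum, ← Finset.sum_add_distrib, ← Finset.sum_add_distrib,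
      ← Finset.sum_add_distrib, ← Finset.sum_add_distrib]
    exact Finset.sum_congr rfl fun i _ => by rw [Fin.sum_univ_three]; ring
  rw [hsum]
  push_cast
  ring

/-! ### The Chebyshev step at the homogeneous law -/

/-- **Velocity fluctuations at the homogeneous law are small.** For a measurable velocity mark
`Y ∈ L²(N(0, θ id))` with mean zero and a continuous weight `χ` on `𝕋³`, under the homogeneous
local Gibbs measures (assumed to be probability measures)
`P_N(η < |(N+1)⁻¹ Σᵢ χ(xᵢ) Y(vᵢ)|) ≤ C² Var(Y) / ((N+1) η²) → 0` (Bienaymé–Chebyshev conditionally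
on the positions, `localGibbsMeasure_velFluct_le`). [folklore] -/
theorem obsLLN_tendsto_velFluct_const {σ θ : ℝ} (hθ : 0 < θ)
    (hP : ∀ N, IsProbabilityMeasure (localGibbsMeasure σ (fun _ => 1) (fun _ => 0) (fun _ => θ) N))
    {Y : V3 → ℝ} (hYm : Measurable Y) (hY2 : MemLp Y 2 (gaussMeasure (0 : V3) θ))
    (hY0 : ∫ v, Y v ∂gaussMeasure (0 : V3) θ = 0) {χ : T3 → ℝ} (hχ : Continuous χ) {η : ℝ}
    (hη : 0 < η) :
    Tendsto (fun N => localGibbsMeasure σ (fun _ => 1) (fun _ => 0) (fun _ => θ) N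
      {z | η < |((N + 1 : ℕ) : ℝ)⁻¹ * ∑ i, χ (z i).1 * Y (z i).2|}) atTop (𝓝 0) := by
  obtain ⟨C, -, hC⟩ := exists_forall_abs_le_of_continuous hχ
  refine tendsto_of_tendsto_of_tendsto_of_le_of_le tendsto_const_nhds
    (tendsto_ofReal_div_succ_mul (C ^ 2 * Var[Y; gaussMeasure (0 : V3) θ]) (η ^ 2))
    (fun N => zero_le) (fun N => ?_)
  haveI := hP N
  refine le_trans (measure_mono fun z hz => ?_)
    (localGibbsMeasure_velFluct_le (a₀ := fun _ => 1) (u₀ := fun _ => 0) (θ₀ := fun _ => θ)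
      continuous_const continuous_const continuous_const (fun _ => zero_le_one) (fun _ => hθ) σ N
      (Y := fun _ v => Y v) (hYm.comp measurable_snd) (fun _ => hY2) (fun _ => hY0)
      (B := Var[Y; gaussMeasure (0 : V3) θ]) (fun _ => le_rfl) hχ hC hη)
  simp only [Set.mem_setOf_eq] at hz ⊢
  exact hz.le

/-! ### The law of large numbers for the observable -/

/-- **Static law of large numbers for the crux observable under the homogeneous local Gibbs law.**
At reduced density `σ` and temperature `θ > 0`, if the homogeneous local Gibbs laws (activity `1`,
mean velocity `0`, temperature `θ`) are probability measures whose empirical density field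
satisfies the law of large numbers with limit `∫ f`, then for continuous `g : 𝕋³ → ℝ³`,
`h : 𝕋³ → ℝ` and `δ > 0` the probability that
`|(N+1)⁻¹ Σᵢ (Σⱼ g(xᵢ)ⱼ vᵢⱼ + h(xᵢ)|vᵢ|²/2) − (3θ/2) ∫ h| > δ` tends to `0`: the momentum part is a
centred Gaussian fluctuation, the kinetic part is `(3θ/2) ×` the density field plus a centred
fluctuation (Maxwellian velocities, `E vⱼ = 0`, `E|v|²/2 = 3θ/2`; Bienaymé–Chebyshev conditionally on
the positions). [folklore] -/
theorem obs_lln_const : ∀ {σ θ : ℝ}, 0 < θ → ∀ (Φ : Flows σ), (∀ N, IsProbabilityMeasure (Literature.MathematicalPhysics.KineticTheory.localGibbsLaw σ (fun _ => 1) (fun _ => 0) (fun _ => θ) N (Φ N))) → (∀ f : T3 → ℝ, Continuous f → ∀ δ : ℝ, 0 < δ → Tendsto (fun N : ℕ => Literature.MathematicalPhysics.KineticTheory.localGibbsLaw σ (fun _ => 1) (fun _ => 0) (fun _ => θ) N (Φ N) {z | δ < |Literature.MathematicalPhysics.KineticTheory.empiricalDensityField z f - ∫ x, f x|}) atTop (𝓝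 0)) → ∀ (g : T3 → V3) (h : T3 → ℝ), Continuous g → Continuous h → ∀ δ : ℝ, 0 < δ → Tendsto (fun N : ℕ => Literature.MathematicalPhysics.KineticTheory.localGibbsLaw σ (fun _ => 1) (fun _ => 0) (fun _ => θ) N (Φ N) {z | δ < |((N : ℝ) + 1)⁻¹ * (∑ i : Fin (N + 1), ((∑ j, g (z i).1 j * (z i).2 j) + h (z i).1 * (‖(z i).2‖ ^ 2 / 2))) - 3 * θ / 2 * ∫ x, h x|}) atTop (𝓝 0) := by
  intro σ θ hθ Φ hP hD g h hg hh δ hδ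
  -- the flow-free local Gibbs measures are probability measures
  have hPM : ∀ N, IsProbabilityMeasure
      (localGibbsMeasure σ (fun _ => 1) (fun _ => 0) (fun _ => θ) N) := fun N =>
    localGibbsLaw_eq σ (fun _ => 1) (fun _ => 0) (fun _ => θ) N (Φ N) ▸ hP N
  have hδ5 : 0 < δ / 5 := by positivity
  have hc : 0 < 3 * θ / 2 := by positivity
  -- (i) the three coordinate velocity fluctuations
  have hcoord : ∀ j : Fin 3, Tendsto (fun N =>
      localGibbsMeasure σ (fun _ => 1) (fun _ => 0) (fun _ => θ) N
        {z | δ / 5 < |((N + 1 : ℕ) : ℝ)⁻¹ * ∑ i, g (z i).1 j * (z i).2 j|}) atTop (𝓝 0) := by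
    intro j
    have hgj : Continuous fun x => g x j := by fun_prop
    exact obsLLN_tendsto_velFluct_const hθ hPM (Y := fun v => v j) (by fun_prop)
      (memLp_coord_gaussMeasure (0 : V3) θ j 2 (by simp))
      (by rw [integral_coord_gaussMeasure _ hθ]; simp) hgj hδ5
  -- (ii) the kinetic-energy fluctuation
  have hW0 : ∫ v, (‖v‖ ^ 2 / 2 - 3 * θ / 2) ∂gaussMeasure (0 : V3) θ = 0 := by
    rw [integral_sub ((integrable_norm_sq_gaussMeasure 0 θ).div_const 2) (integrable_const _),
      integral_div, integral_norm_sq_gaussMeasure 0 hθ, integral_const]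
    simp
  have henergy : Tendsto (fun N =>
      localGibbsMeasure σ (fun _ => 1) (fun _ => 0) (fun _ => θ) N
        {z | δ / 5 < |((N + 1 : ℕ) : ℝ)⁻¹ * ∑ i, h (z i).1 * (‖(z i).2‖ ^ 2 / 2 - 3 * θ / 2)|})
      atTop (𝓝 0) :=
    obsLLN_tendsto_velFluct_const hθ hPM (Y := fun v => ‖v‖ ^ 2 / 2 - 3 * θ / 2) (by fun_prop)
      (memLp_energy_gaussMeasure (0 : V3) θ (3 * θ / 2)) hW0 hh hδ5
  -- (iii) the density term (the hypothesis)
  have hdens : Tendsto (fun N =>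
      localGibbsMeasure σ (fun _ => 1) (fun _ => 0) (fun _ => θ) N
        {z | δ / 5 < |3 * θ / 2 * (((N + 1 : ℕ) : ℝ)⁻¹ * (∑ i, h (z i).1) - ∫ x, h x)|})
      atTop (𝓝 0) := by
    refine (hD h hh (δ / 5 / (3 * θ / 2)) (by positivity)).congr fun N => ?_
    rw [localGibbsLaw_eq]
    congr 1
    ext z
    simp only [Set.mem_setOf_eq, empiricalDensityField_eq_sum, abs_mul, abs_of_pos hc,
      div_lt_iff₀ hc]
    constructor <;> intro h' <;> linarith
  -- assembly: union bound at levels `δ / 5`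
  have hall := obsLLN_tendsto_measure_lt_abs_add (obsLLN_tendsto_measure_lt_abs_add
    (obsLLN_tendsto_measure_lt_abs_add (obsLLN_tendsto_measure_lt_abs_add (hcoord 0) (hcoord 1))
      (hcoord 2)) henergy) hdens
  refine hall.congr fun N => ?_
  rw [localGibbsLaw_eq]
  congr 1
  ext z
  simp only [Set.mem_setOf_eq]
  rw [obsLLN_sub_limit_split z g h θ (∫ x, h x),
    show δ / 5 + δ / 5 + δ / 5 + δ / 5 + δ / 5 = δ by ring]

end

end Summit.AtomisticToContinuum.HydrodynamicLimit.Theorems.HemisphereAffineSlaving
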